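import Summits.CriticalPhenomena.PercolationContinuityZ3.Theorems.PercNearOneGluingNoHeavyQuantIndepBlobMoments
import HarnessLib

/-!
# QUANT lane R8, independent blobs: the CLOSURE UNION BOUND `P(N ≤ j) ≤ Σ_{Z minimal fatal} Π_{k∈Z} (1 − p k)`
# (first Bonferroni bound on the CLOSED side) — the numerically complete certificate of the DIB\* corner

builds on p205010 (kernel theorem, internal audit signed; external expert review pending)

Support file (`--supports stmt-CriticalPhenomena-4575`), QUANT lane seat prim-quant-p1 (gen 11); memo
`run/shared/lean/prim/quant/P1-SURPLUS.md` §22.6.  Theorems only; no definitions, no sorries, standard axioms.  Vocabulary of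
`…QuantIndepBlobMoments` (blobs `κ`, gates `p`, sizes `a`, configurations `W : Finset κ` = the OPEN blobs, product weight
`∏ (p k if k ∈ W else 1 − p k)`).

A set `Z` of blobs is FATAL (at layer `j`) if closing it leaves at most `j` open mass: `Σ_{k ∉ Z} a k ≤ j`.  The event `{N ≤ j}` is the event
"some minimal fatal set is entirely closed", so by the union bound
`P(N ≤ j) ≤ Σ_{Z ∈ 𝓜} Π_{k ∈ Z} (1 − p k)` for every family `𝓜` that contains, for every configuration `W` with `a(W) ≤ j`, a member disjoint
from `W` (`lowerTail_le_closureUnionBound`); the family of all inclusion-minimal fatal sets is such a family (`lowerTail_le_sum_minimalFatal`).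

WHY (memo §22.6): on the open corner of Conjecture DIB\* (`Quant.IndepBlob.DIBStar`: floor `x > 1/2`, heavy total `≤ 2j`, light sizes `≤ j`,
discounted credit `> 2j`) this bound is `≤ 1 − x` on EVERY sampled instance — exhaustive grids (den 12 / 20, ≤ 4 blobs) and 1.4·10⁵ random
instances with up to 12 blobs over `x ∈ (1/2, 0.999)`: 0 failures, `max UB/(1−x) = 1` exactly at heavy giants and `≈ 0.98` at three near-tied
units — while merge / Markov / Cantelli together leave ≈ 1 % uncertified.  So (Conjecture CUB, memo §22.6) the DIB\* corner is, numerically, a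
FIRST-MOMENT statement on the closed side; this file supplies the kernel half `P(N ≤ j) ≤ UB` (rule υ for the certificate menu of
`…QuantDIBStar`), the deterministic half `UB ≤ 1 − x` is open.

* `IndepBlob.sum_bernoulliWeight_mul_prod_notMem` — `E[∏_{i∈T} 𝟙[i closed]] = ∏_{i∈T} (1 − p i)` (complement symmetry).
* `IndepBlob.lowerTail_le_closureUnionBound` — the union bound for any covering family `𝓜`.
* `IndepBlob.lowerTail_le_sum_minimalFatal` — with `𝓜` = the inclusion-minimal fatal sets; `IndepBlob.tail_ge_one_sub_closureUnionBound` — tail form.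
[cite: KozmaNitzan2024, Conjecture 3 (p. 15)] (the gluing rows served); [folklore] (Bonferroni) in this vocabulary, the use is [this work].
-/

namespace Summit.CriticalPhenomena.PercolationContinuityZ3.Theorems

namespace Quant

namespace IndepBlob

open Finset

variable {κ : Type*} [Fintype κ] [DecidableEq κ]

/-- **Closed-set moments**: `Σ_W w(W)·∏_{i∈T} 𝟙[i ∉ W] = ∏_{i∈T} (1 − p i)` — the probability that every blob of `T` is closed.
(Complement symmetry `W ↦ Wᶜ` turns the `p`-weights into the `(1−p)`-weights, then `sum_bernoulliWeight_mul_prod_indicator`.) [folklore] -/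
theorem sum_bernoulliWeight_mul_prod_notMem (p : κ → ℝ) (T : Finset κ) :
    ∑ W : Finset κ, (∏ k, if k ∈ W then p k else 1 - p k) * ∏ i ∈ T, (if i ∉ W then (1 : ℝ) else 0) =
      ∏ i ∈ T, (1 - p i) := by
  have key := sum_bernoulliWeight_mul_prod_indicator (fun k => 1 - p k) T
  rw [← key]
  refine Fintype.sum_bijective (fun W : Finset κ => Wᶜ) (Function.Involutive.bijective compl_compl) _ _ fun W => ?_
  have h1 : (∏ k, if k ∈ W then p k else 1 - p k) = ∏ k, (if k ∈ Wᶜ then 1 - p k else 1 - (1 - p k)) := by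
    refine Finset.prod_congr rfl fun k _ => ?_
    by_cases hk : k ∈ W
    · rw [if_pos hk, if_neg (fun h => (Finset.mem_compl.1 h) hk), sub_sub_cancel]
    · rw [if_neg hk, if_pos (Finset.mem_compl.2 hk)]
  have h2 : ∏ i ∈ T, (if i ∉ W then (1 : ℝ) else 0) = ∏ i ∈ T, (if i ∈ Wᶜ then (1 : ℝ) else 0) := by
    refine Finset.prod_congr rfl fun i _ => ?_
    simp only [Finset.mem_compl]
  rw [h1, h2]

/-- **The closure union bound.**  Gates in `[0,1]`, sizes `a`, layer `j`, and a family `𝓜` of blob sets such that every configuration `W`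
(= set of OPEN blobs) with `a(W) ≤ j` leaves some member of `𝓜` entirely closed (`Z ∈ 𝓜` disjoint from `W`).  Then
`P(N ≤ j) = Σ_{W : a(W) ≤ j} w(W) ≤ Σ_{Z ∈ 𝓜} ∏_{k ∈ Z} (1 − p k)`. [this work] -/
theorem lowerTail_le_closureUnionBound (p : κ → ℝ) (a : κ → ℕ) (hp0 : ∀ k, 0 ≤ p k) (hp1 : ∀ k, p k ≤ 1) (j : ℕ)
    (𝓜 : Finset (Finset κ)) (hcover : ∀ W : Finset κ, ∑ k ∈ W, a k ≤ j → ∃ Z ∈ 𝓜, Disjoint Z W) :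
    ∑ W ∈ (Finset.univ : Finset (Finset κ)).filter (fun W => ∑ k ∈ W, a k ≤ j), (∏ k, if k ∈ W then p k else 1 - p k) ≤
      ∑ Z ∈ 𝓜, ∏ k ∈ Z, (1 - p k) := by
  have hw0 : ∀ W : Finset κ, 0 ≤ (∏ k, if k ∈ W then p k else 1 - p k) := bernoulliWeight_nonneg hp0 hp1
  -- pointwise: 𝟙[a(W) ≤ j] ≤ Σ_{Z∈𝓜} ∏_{i∈Z} 𝟙[i ∉ W]
  have hpt : ∀ W : Finset κ, (if ∑ k ∈ W, a k ≤ j then (1 : ℝ) else 0) ≤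
      ∑ Z ∈ 𝓜, ∏ i ∈ Z, (if i ∉ W then (1 : ℝ) else 0) := by
    intro W
    have hnn : ∀ Z ∈ 𝓜, (0 : ℝ) ≤ ∏ i ∈ Z, (if i ∉ W then (1 : ℝ) else 0) :=
      fun Z _ => Finset.prod_nonneg fun i _ => by split_ifs <;> norm_num
    split_ifs with hW
    · obtain ⟨Z, hZ, hdis⟩ := hcover W hW
      have hone : ∏ i ∈ Z, (if i ∉ W then (1 : ℝ) else 0) = 1 :=
        Finset.prod_eq_one fun i hi => by rw [if_pos (Finset.disjoint_left.1 hdis hi)]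
      exact hone.symm.le.trans (Finset.single_le_sum hnn hZ)
    · exact Finset.sum_nonneg hnn
  calc ∑ W ∈ (Finset.univ : Finset (Finset κ)).filter (fun W => ∑ k ∈ W, a k ≤ j), (∏ k, if k ∈ W then p k else 1 - p k)
      = ∑ W : Finset κ, (∏ k, if k ∈ W then p k else 1 - p k) * (if ∑ k ∈ W, a k ≤ j then (1 : ℝ) else 0) := by
        rw [Finset.sum_filter]
        refine Finset.sum_congr rfl fun W _ => ?_
        split_ifs <;> simp
    _ ≤ ∑ W : Finset κ, (∏ k, if k ∈ W then p k else 1 - p k) * ∑ Z ∈ 𝓜, ∏ i ∈ Z, (if i ∉ W then (1 : ℝ) else 0) :=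
        Finset.sum_le_sum fun W _ => mul_le_mul_of_nonneg_left (hpt W) (hw0 W)
    _ = ∑ Z ∈ 𝓜, ∑ W : Finset κ, (∏ k, if k ∈ W then p k else 1 - p k) * ∏ i ∈ Z, (if i ∉ W then (1 : ℝ) else 0) := by
        rw [Finset.sum_comm]
        exact Finset.sum_congr rfl fun W _ => Finset.mul_sum _ _ _
    _ = ∑ Z ∈ 𝓜, ∏ k ∈ Z, (1 - p k) :=
        Finset.sum_congr rfl fun Z _ => sum_bernoulliWeight_mul_prod_notMem p Z

/-- **Closure union bound over the MINIMAL FATAL sets.**  `Z` is fatal if `Σ_{k ∉ Z} a k ≤ j`, minimal if no `Z.erase k` is fatal; every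
configuration with `a(W) ≤ j` has `Wᶜ` fatal, hence contains a minimal fatal set, so
`P(N ≤ j) ≤ Σ_{Z minimal fatal} ∏_{k∈Z} (1 − p k)`. [this work] -/
theorem lowerTail_le_sum_minimalFatal (p : κ → ℝ) (a : κ → ℕ) (hp0 : ∀ k, 0 ≤ p k) (hp1 : ∀ k, p k ≤ 1) (j : ℕ) :
    ∑ W ∈ (Finset.univ : Finset (Finset κ)).filter (fun W => ∑ k ∈ W, a k ≤ j), (∏ k, if k ∈ W then p k else 1 - p k) ≤
      ∑ Z ∈ (Finset.univ : Finset (Finset κ)).filter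
          (fun Z => ∑ k ∈ Zᶜ, a k ≤ j ∧ ∀ i ∈ Z, ¬ (∑ k ∈ (Z.erase i)ᶜ, a k ≤ j)),
        ∏ k ∈ Z, (1 - p k) := by
  refine lowerTail_le_closureUnionBound p a hp0 hp1 j _ fun W hW => ?_
  -- the fatal subsets of `Wᶜ`; pick one of least cardinality
  set F : Finset (Finset κ) := (Wᶜ).powerset.filter (fun Z => ∑ k ∈ Zᶜ, a k ≤ j) with hF
  have hWc : Wᶜ ∈ F := by
    rw [hF, Finset.mem_filter]
    refine ⟨Finset.mem_powerset.2 subset_rfl, ?_⟩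
    rw [compl_compl]; exact hW
  obtain ⟨Z, hZF, hZmin⟩ := Finset.exists_min_image F Finset.card ⟨Wᶜ, hWc⟩
  rw [hF, Finset.mem_filter, Finset.mem_powerset] at hZF
  refine ⟨Z, Finset.mem_filter.2 ⟨Finset.mem_univ _, hZF.2, fun i hi hfat => ?_⟩, ?_⟩
  · -- `Z.erase i` would be a smaller fatal subset of `Wᶜ`
    have hmem : Z.erase i ∈ F := by
      rw [hF, Finset.mem_filter, Finset.mem_powerset]
      exact ⟨(Finset.erase_subset i Z).trans hZF.1, hfat⟩
    have := hZmin (Z.erase i) hmem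
    rw [Finset.card_erase_of_mem hi] at this
    have hpos : 0 < Z.card := Finset.card_pos.2 ⟨i, hi⟩
    omega
  · exact Finset.disjoint_left.2 fun k hkZ hkW => (Finset.mem_compl.1 (hZF.1 hkZ)) hkW

/-- **Tail form (rule υ).**  `P(N ≥ j+1) ≥ 1 − Σ_{Z ∈ 𝓜} ∏_{k∈Z} (1 − p k)` for every covering family `𝓜` as in
`lowerTail_le_closureUnionBound`; in particular a floor `x` is certified as soon as that sum is `≤ 1 − x`. [this work] -/
theorem tail_ge_one_sub_closureUnionBound (p : κ → ℝ) (a : κ → ℕ) (hp0 : ∀ k, 0 ≤ p k) (hp1 : ∀ k, p k ≤ 1) (j : ℕ)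
    (𝓜 : Finset (Finset κ)) (hcover : ∀ W : Finset κ, ∑ k ∈ W, a k ≤ j → ∃ Z ∈ 𝓜, Disjoint Z W) :
    1 - ∑ Z ∈ 𝓜, ∏ k ∈ Z, (1 - p k) ≤
      ∑ s ∈ (Finset.univ : Finset (Finset κ)).filter (fun s => j + 1 ≤ ∑ k ∈ s, a k), (∏ k, if k ∈ s then p k else 1 - p k) := by
  have h := lowerTail_le_closureUnionBound p a hp0 hp1 j 𝓜 hcover
  have hnot : (Finset.univ : Finset (Finset κ)).filter (fun s => ¬ (j + 1 ≤ ∑ k ∈ s, a k)) =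
      (Finset.univ : Finset (Finset κ)).filter (fun W => ∑ k ∈ W, a k ≤ j) := by
    ext W
    simp only [Finset.mem_filter, Finset.mem_univ, true_and, not_le, Nat.lt_succ_iff]
  have htot : ∑ s ∈ (Finset.univ : Finset (Finset κ)).filter (fun s => j + 1 ≤ ∑ k ∈ s, a k),
      (∏ k, if k ∈ s then p k else 1 - p k) +
      ∑ W ∈ (Finset.univ : Finset (Finset κ)).filter (fun W => ∑ k ∈ W, a k ≤ j),
      (∏ k, if k ∈ W then p k else 1 - p k) = 1 := by
    rw [← hnot, Finset.sum_filter_add_sum_filter_not, sum_bernoulliWeight]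
  linarith

end IndepBlob

end Quant

end Summit.CriticalPhenomena.PercolationContinuityZ3.Theorems
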